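import Summits.QuantumFields.YangMills.Theorems.UnitScaleTiltProp7SectET3LandauOpRows127T3
import Summits.QuantumFields.YangMills.Theorems.UnitScaleTiltProp7Size19Orders01T3
import Summits.QuantumFields.YangMills.Theorems.UnitScaleTiltProp7ChartDatumSplit
import Summits.QuantumFields.YangMills.Theorems.UnitScaleTiltProp7HDsolAtRecordOfRows
import HarnessLib

/-!
# Route `UnitScaleTilt`, crux «MinimiserStabilityRegPr» (stmt-QuantumFields-19200, stub EX `stub_existenceMinimalOrbit`), route (α), node N06(d = 3) —
# **«HDSOL-127» (GENERIC HESSIAN SLOT): THE MEMBER JUNCTION OF THE EX DISPLAY'S ROW `hΔsol` ([Balaban1985Variational] (136) + its `D*D` companion for THE solution of (111))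
# AT THE LETTERS OF RECORD, FROM THE FOUR BACKGROUND-LEVEL OPERATOR ROWS `hOpC h137 hOp139 hOp349`** (EX knit namer ★w2-19200 g6 (G17)∕(G17′) «px16: HDSOL-AT-RECORD GO»)

Cell `ym3-torus` (HUMAN RULING D-0037, YM ladder rung R3 — YM₃ on T³ is a rung, NOT d = 4, NOT a mass gap, NOT Clay), width seat `ym3-torus-px16` (gen 2).  THEOREMS ONLY (0 `def`,
0 `sorry`); `--supports stmt-QuantumFields-19200 --as helper`; count-neutral.  A composition BY NAME of landed member theorems; the four operator rows are DISPLAYED (N06(d = 3) storey);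
NO claim on the crux, the stub, d = 4 or the gap.

THE PRINT.  [Balaban1985Variational] p. 298–299: *«(Δ + DRD*)A₀ = −P₀*J + P₀*Δ⁽²⁾A′₁ − P₀*((δ∕δA′)V)(A′₁) (133) … the right-hand side of (133) can be estimated by O(1)C₁B₃ε₁(Lʲη)⁻³ on Ω_j
… |Δ_{U₀}A′₁| < O(1)C₁B₃ε₁(Lʲη)⁻³ on Ω_j (136) … Thus we have proved finally that the configuration A′₁ = A₁ + H₁B satisfies the condition (ii) with ε₂ = O(1)C₁B₃ε₁ (140)»*; p. 295
(116) *«ε₄ = 3B₀C₁B₃ε₁»* (Prop. 6: the size of the unique solution of (111)); (103) p. 293 `A′ = A₁ + H₁B`, (117) `|H₁B| ≤ B₀|B|`; (20) p. 281 `|B| < 2dLC₁ε₁`; (28) p. 282 `|J| ≤ C₁B₃ε₁`;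
(97) p. 292 `|((δ∕δA′)V)(A′)| ≤ C₄|A′|²`.  At the one-level T³ member: `C₁ = L³`, `B₃ = 3L`, `ρ := C₁B₃ε₁ = L³·3L·ε₁`, every (115)-weight is `1` (`Lᵏη = 1`).

WHAT IS PROVED (ns `…Theorems.Prop7HDsolAtRecordOfRows`; member `F n K`, `h : n ≤ K`, weights `c₀ cB a`, background `U₀`, coarse datum field `V`):
* §1 the size bookkeeping of the (111)-data in `L²` letters (pure readback; [folklore] over ✓`toL2_symm_apply`, ✓`funEquiv_symm_apply`, ✓`norm_negSize_const_eq`):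
  `norm_toL2_symm_funEquiv_symm_apply` (`toL2⁻¹(funEquiv⁻¹ g) bd = g (bondEquiv bd)`), `norm_negSup_equiv_apply_le` (`‖(NegSup.equiv J) p‖ ≤ ‖J‖` at the member's unit weights),
  `norm_jetRead_apply_le` (`‖ι f b‖ ≤ ‖f‖`).
* §2 ★★★ **`hΔsol_at_record_of_rows`** — CONCLUSION = the EX display's `hΔsol` MEMBER TEXT VERBATIM (✓p660931 `stubEX_of_chartPiecesTwS9` :153–171 read at `L := F.L`, `i := (F, n, K)`):
  for the displayed solution `A₁` of (111) (`‖A₁‖ < r`, `A₁ + 𝔊J(U₀) + 𝔊W(A₁ + H₁B̃) = 0` at `𝔊 := frakGfR …Δ_π… U₀`, `H₁ := H1f …Δ_π… U₀`, `J := Jcur (bgOfCfg F K U₀)`, `W` OPAQUE of the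
  knit's `Wf L i U₀` type, `B̃ c = −i·mlog(V c·Ū₀(c)*)`), BOTH second-order members of (19) for `Yf := ιA₁ + ι(H₁B̃)` are `≤ MΔ·ρ·η²`, `ρ = L³·3L·ε₁`, with the EXPLICIT
  `MΔ := (1 + 25·C₄·B₀²) + cC·(1 + 25·C₄·B₀²) + c137·2 + k139·(10B₀)∕2 + 14·(10B₀) + k349·(10B₀)∕2 + 2·(10B₀)` — FROM: the prefix (`0 < ε₁`, `RegPr F n K ρ U₀`,
  `CloseAvg F n K h (L³ε₁) V U₀`, `L³ε₁ ≤ 1∕2`, `ρ ≤ 1`), the class `hp : PosOnto … Δx U₀` (S11's `hPos`) and the slot rows `hkill horth`, the knit's `norm_G`∕`quad`∕`norm_H₁` at the letters of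
  record, `0 < B₀`, `0 < C₄`, Prop. 6's three windows in ✓`orders01_of_eq111_T3`'s letters (`2B₀ρ ≤ r`, `4r ≤ a₃`, `16B₀C₄r ≤ 1`), and ★px5 g2's FOUR DISPLAYED BACKGROUND-LEVEL ROWS
  `hOpC h137 hOp139 hOp349` BYTE-EXACT (✓`Prop7SectET3LandauOpRows.secondOrder_of_eq111_opRows_rho`, EX namer (G18): «THE EX residue-row shapes of record»).  INSIDE (not displayed):
  (28) `‖J‖ ≤ ρ` (✓`norm_Jcur_le` ∘ ✓`inU2cur_bgOfCfg_of_regPr` ∘ ✓`isUnitaryBg_bgOfCfg`), Prop. 6's uniqueness ⇒ `‖A₁‖ < 3B₀ρ` (✓`prop6_bgOfCfg`), (20) `‖B̃‖ < 2ρ`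
  (✓`bound20_symLog_of_closeAvg`), (117) + (97) ⇒ `‖Ĵ + Ŵ‖ ≤ (1 + 25C₄B₀²)ρ`, `nY := 5B₀ρ`, `sb := 2ρ`; the `L²` reading of (111) ✓`toL2_iota_eq111`; the Landau row of the solution and the
  two field-level rows `h139sol`∕`hDPD` are ★px5's §3∕§5 (✓`RS_DstarL2_sol`).
INHABITABILITY (★★OWNER RULING g27-№9 (3)), per displayed row: `hOpC` — [B9] Thm 3.3 (n = 0, 1) + (3.49) for `Q†(QGQ*)⁻¹QG + DR_SD*G` (N06; at fixed `(F, K)` a finite-dimensional operator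
bound, trivially inhabited by SOME `cC`; the content is `cC` uniform in `K`); `h137` — (137)'s block letter `Q†((QGQ*)⁻¹ − a)` ([B9] Thm 3.11∕(3.126); same remark); `hOp139` — (138) +
«`G′RD*` bounded in |·|₍₁₎» (p. 299 l. 6); `hOp349` — (3.49) «`DPD*` bounded» (p. 299 l. 13); all four mention only the landed bricks' `L²` letters (no `H`, `Y`, `B̃`, solution letter), are
satisfied at `X = 0`∕`x = 0`∕`Y = 0` trivially and are EXACTLY the rows of ✓`secondOrder_of_eq111_opRows_rho` ∕ ✓`hΔH_of_opRows` (shared with `h46₂`'s descent).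
HONEST SCOPE.  Size bookkeeping + one call; NO estimate of [B9]∕[B11] proved; the rows ARE the content; not a proof of any stub; nothing continuum ∕ OS ∕ mass-gap ∕ Clay.

References: T. Bałaban, CMP **102** (1985) 277–309 [Balaban1985Variational] ((19)–(20) p.281, (28) p.282, (97) p.292, (103) p.293, (111) p.294, (115)–(117) pp.294–295, Prop. 6
p.295, (133)–(140) pp.298–299); CMP **99** (1985) 389–434 [Balaban1985BackgroundPropagators] ((3.49) p.399, Thm 3.11 p.418, (3.119)–(3.126) pp.419–420).
-/

set_option autoImplicit false

noncomputable section

open scoped InnerProductSpace ComplexConjugate Matrix.Norms.L2Operator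

namespace Summit.QuantumFields.YangMills.Theorems.Prop7HDsolAtRecordOfRows127

open Literature.MathematicalPhysics.QuantumFieldTheory.Balaban1983to89
open Literature.MathematicalPhysics.QuantumFieldTheory.Balaban1983to89.T3ContinuumYM3Torus
open Literature.MathematicalPhysics.QuantumFieldTheory.Balaban1983to89.T3PrintedRegularMinimiser (RegPr)
open Literature.MathematicalPhysics.QuantumFieldTheory.Balaban1983to89.T3UnitLawDensityEML (ℰp)
open Literature.MathematicalPhysics.QuantumFieldTheory.Balaban1983to89.T3TiltDescent (descendTo)
open T3SectALandauChart (eta eta_pos covCodiffCurlT covLapFormT bgUnits CloseAvg)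
open B9SectCLatticeCarrier (Bond)
open B9Eq311L2Pairing (WL2)
open B11Eq115Space (NegSize NegSup Space115 JetSup levWeight)
open B11Eq111FrakG (nabla115)
open B11Eq103H1Complex (SiteL2K BondL2K funEquiv funEquiv_symm_apply)
open B11Eq98CurrentSlot (Jcur norm_Jcur_le)
open B13Contraction113 (QuadAnalytic)
open MatrixLog (mlog)
open Summit.QuantumFields.YangMills.Theorems.Prop7SectET3Transport (periodsT3 bondEquiv bgOfCfg isUnitaryBg_bgOfCfg levWeight_const_eq_one norm_negSize_const_eq)
open Summit.QuantumFields.YangMills.Theorems.Prop7SectET3HilbertLetters (W₂ frobEquiv toL2 toL2S toL2B DL2 DstarL2 toL2_symm_apply)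
open Summit.QuantumFields.YangMills.Theorems.Prop7SectET3GaugeProjector (NS RS)
open Summit.QuantumFields.YangMills.Theorems.Prop7SectET3WilsonHessian (DeltaEta)
open Summit.QuantumFields.YangMills.Theorems.Prop7SectET3CurvedPropagators
open Summit.QuantumFields.YangMills.Theorems.Prop7SectET3DeltaPi
open Summit.QuantumFields.YangMills.Theorems.Prop7SectET3Objects (inU2cur_bgOfCfg_of_regPr prop6_bgOfCfg)
open Summit.QuantumFields.YangMills.Theorems.Prop7Bound20SymLog (bound20_symLog_of_closeAvg)
open Summit.QuantumFields.YangMills.Theorems.Prop7HessRowOfEq111 (toL2_iota_eq111)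
open Summit.QuantumFields.YangMills.Theorems.Prop7SectET3LandauOpRows127 (secondOrder_of_eq111_opRows127_rho)
open Summit.QuantumFields.YangMills.Theorems.Prop7ChartDatumSplit (norm_jetRead_le)
open Summit.QuantumFields.YangMills.Theorems.Prop7HDsolAtRecordOfRows (toL2_symm_funEquiv_symm_apply norm_negSup_equiv_apply_le norm_jetRead_apply_le)

variable {F : T3Family} {n K : ℕ} {c₀ : ℝ} [Fact (0 < c₀)]

/-! ## §2 The junction: S9's `hΔsol` member text from the four operator rows -/

set_option maxHeartbeats 400000 in
-- HEARTBEAT rule (README): the statement carries the member's full letter terms (`frakGfR`, `H1f`, the slot `Δx`, `LinearMap.adjoint (Qk …)`, `KinvT`, `GT`); the E2-133∕OP-ROWS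
-- junctions it calls measured > 200k at elaboration.
/-- ★★★ **`hΔsol` AT THE LETTERS OF RECORD, FROM THE FOUR OPERATOR ROWS** (module docstring §2): S9's displayed `hΔsol` member text with `MΔ` EXPLICIT, from the prefix, the class, the
knit's `norm_G`∕`quad`∕`norm_H₁`, Prop. 6's windows, the displayed solution of (111), and ★px5's `hOpC h137 hOp139 hOp349`.
[cite: Balaban1985Variational, (136) p.298, (140) p.299, Prop. 6 p.295, (116)–(117) p.295, (20) p.281, (28) p.282, (97) p.292, (19) p.281; Balaban1985BackgroundPropagators, (3.49) p.399, (3.126) p.420] -/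
theorem hΔsol_at_record_of_rows127 (F : T3Family) (n K : ℕ) (h : n ≤ K) [Fact (0 < (F.L : ℝ))] [Fact (0 < ((F.L : ℝ)⁻¹) ^ (K - n))]
    {c₀ cB a : ℝ} [Fact (0 < c₀)] [Fact (0 < cB)]
    -- THE HESSIAN SLOT, GENERIC (★w2-19200 g6 standing instruction (D): `Δx` + slot rows, never `hq : PosPrime`)
    {Δx : GaugeField (F.P K) 0 (Matrix.specialUnitaryGroup (Fin 2) ℂ) → (BondL2K ℂ 3 (periodsT3 F K) c₀ W₂ →ₗ[ℂ] BondL2K ℂ 3 (periodsT3 F K) c₀ W₂)}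
    (U₀ : GaugeField (F.P K) 0 (Matrix.specialUnitaryGroup (Fin 2) ℂ)) (V : GaugeField (F.P n) 0 (Matrix.specialUnitaryGroup (Fin 2) ℂ))
    -- the ONE opaque letter of the knit, print's `(δ∕δA′)V`, in S9's `Wf L i U₀` type
    (W : Space115 (F.L : ℝ) (((F.L : ℝ)⁻¹) ^ (K - n)) (fun _ : Bond 3 (periodsT3 F K) => K - n) (fun _ : Bond 3 (periodsT3 F K) × Fin 3 => K - n)
            (nabla115 (((F.L : ℝ)⁻¹) ^ (K - n)) (bgOfCfg F K U₀)) →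
          NegSize (F.L : ℝ) (((F.L : ℝ)⁻¹) ^ (K - n)) (fun _ : Bond 3 (periodsT3 F K) => K - n) 3 (Matrix (Fin 2) (Fin 2) ℂ))
    {B₀ C₄ a₃ r ε₁ cC c137 k139 k349 : ℝ} (hB₀ : 0 < B₀) (hC₄ : 0 < C₄) (hε₁ : 0 < ε₁)
    -- the prefix of S9's `hΔsol` at the member (+ the two numerals the knit derives from `ρ ≤ α ≤ 10⁻¹²L⁻³`)
    (hreg : RegPr F n K ((F.L : ℝ) ^ 3 * (3 * (F.L : ℝ)) * ε₁) U₀) (hclose : CloseAvg F n K h ((F.L : ℝ) ^ 3 * ε₁) V U₀)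
    (hwin : (F.L : ℝ) ^ 3 * ε₁ ≤ 1 / 2) (hρ1 : (F.L : ℝ) ^ 3 * (3 * (F.L : ℝ)) * ε₁ ≤ 1)
    -- the class (`hPos` at this background) and the two slot rows (E2-133 §1's `hΔ hΔ′`; PROVED for `DeltaPiSlotP`∕`DeltaOnePJ` in ✓∕⧗`…SectET3DeltaPiT3PInv`)
    (hp : PosOnto F n K h c₀ cB a Δx U₀)
    (hkill : ∀ l ∈ NS F n K h c₀ cB U₀, Δx U₀ (DL2 F n K c₀ U₀ l) = 0) (horth : ∀ l ∈ NS F n K h c₀ cB U₀, ∀ w, ⟪DL2 F n K c₀ U₀ l, Δx U₀ w⟫_ℂ = 0)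
    -- the knit's letter rows AT THE LETTERS OF RECORD (`norm_G` at `frakGfR …Δ_π…`, `prop4`'s size clause at the opaque `W`, `norm_H₁` at `H1f …Δ_π…`)
    (norm_G : ∀ f, ‖frakGfR F n K h c₀ cB a Δx U₀ f‖ ≤ B₀ * ‖f‖) (quad : QuadAnalytic W C₄ a₃)
    (norm_H₁ : ∀ b, ‖H1f F n K h c₀ cB a Δx U₀ b‖ ≤ B₀ * ‖b‖)
    -- Prop. 6's windows in its own letters (`ε₄ := r`, `C₁ := L³`, `B₃ := 3L`)
    (h1 : 2 * B₀ * (F.L : ℝ) ^ 3 * (3 * (F.L : ℝ)) * ε₁ ≤ r) (h2 : 4 * r ≤ a₃) (h3 : 16 * B₀ * C₄ * r ≤ 1)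
    -- THE FOUR DISPLAYED BACKGROUND-LEVEL ROWS (★px5 g2 «OP-ROWS-127» texts BYTE-EXACT: tube-only `hOpC′`, generic-`Y` `h137`, slot-defect `hOp139′`, `hOp349`)
    (hOpC : ∀ (x : BondL2K ℂ 3 (periodsT3 F K) c₀ W₂) (bd : PBond (F.P K) 0),
      ‖(toL2 F K c₀).symm (LinearMap.adjoint (Qk F n K h c₀ cB U₀) (KinvT F n K h c₀ cB a Δx U₀ (Qk F n K h c₀ cB U₀ (GT F n K h c₀ cB a Δx U₀ x)))) bd‖
        ≤ cC * ‖(toL2 F K c₀).symm x‖)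
    (h137 : ∀ (Y : PBond (F.P n) 0 → Matrix (Fin 2) (Fin 2) ℂ) (b : PBond (F.P K) 0),
      ‖(toL2 F K c₀).symm (LinearMap.adjoint (Qk F n K h c₀ cB U₀) (KinvT F n K h c₀ cB a Δx U₀ (toL2B F n cB Y))
          - LinearMap.adjoint (Qk F n K h c₀ cB U₀) (((a : ℂ)) • toL2B F n cB Y)) b‖ ≤ c137 * ‖Y‖)
    (hOp139 : ∀ (X : PBond (F.P K) 0 → Matrix (Fin 2) (Fin 2) ℂ) (s : ℝ), RS F n K h c₀ cB U₀ (DstarL2 F n K c₀ U₀ (toL2 F K c₀ X)) = 0 → (∀ bd, ‖X bd‖ ≤ s) →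
      ∀ bd : PBond (F.P K) 0, ‖(toL2 F K c₀).symm (DeltaEta F n K c₀ U₀ (toL2 F K c₀ X) - Δx U₀ (toL2 F K c₀ X)) bd‖ ≤ k139 * s)
    (hOp349 : ∀ (X : PBond (F.P K) 0 → Matrix (Fin 2) (Fin 2) ℂ) (s : ℝ), (∀ bd, ‖X bd‖ ≤ s) → ∀ bd : PBond (F.P K) 0,
      ‖(toL2 F K c₀).symm (DL2 F n K c₀ U₀ (DstarL2 F n K c₀ U₀ (toL2 F K c₀ X) - RS F n K h c₀ cB U₀ (DstarL2 F n K c₀ U₀ (toL2 F K c₀ X)))) bd‖ ≤ k349 * s)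
    -- the displayed solution of (111) (S9's `A₁`, `‖A₁‖ < r L`, `heq` text at the letters of record)
    (A₁ : Space115 (F.L : ℝ) (((F.L : ℝ)⁻¹) ^ (K - n)) (fun _ : Bond 3 (periodsT3 F K) => K - n) (fun _ : Bond 3 (periodsT3 F K) × Fin 3 => K - n)
      (nabla115 (((F.L : ℝ)⁻¹) ^ (K - n)) (bgOfCfg F K U₀)))
    (hA₁ : ‖A₁‖ < r)
    (heq : A₁ + frakGfR F n K h c₀ cB a Δx U₀ (Jcur (bgOfCfg F K U₀))
        + frakGfR F n K h c₀ cB a Δx U₀ (W (A₁ + H1f F n K h c₀ cB a Δx U₀ (fun c : PBond (F.P n) 0 =>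
          (-Complex.I) • mlog (((V c : Matrix.specialUnitaryGroup (Fin 2) ℂ) : Matrix (Fin 2) (Fin 2) ℂ)
            * star ((descendTo F ℰp n K h U₀ c : Matrix.specialUnitaryGroup (Fin 2) ℂ) : Matrix (Fin 2) (Fin 2) ℂ))))) = 0)
    -- ONE displayed identity about THE solution: the Landau-constraint multiplier of (111)'s residual vanishes (print's (127) consequence; ★px21's
    -- ⧗`mult_eq_zero_of_inner_DL2_NS` turns the background×data row `∀ l ∈ N_S, ⟪x, DL2 l⟫ = 0` into it)
    (hmult : DL2 F n K c₀ U₀ (RS F n K h c₀ cB U₀ (DstarL2 F n K c₀ U₀ (GT F n K h c₀ cB a Δx U₀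
      ((funEquiv frobEquiv (fun _ : Bond 3 (periodsT3 F K) => c₀)).symm
        (NegSup.equiv _ _ (Jcur (L := (F.L : ℝ)) (η := ((F.L : ℝ)⁻¹) ^ (K - n)) (lev₀ := fun _ : Bond 3 (periodsT3 F K) => K - n) (bgOfCfg F K U₀))
          + NegSup.equiv _ _ (W (A₁ + H1f F n K h c₀ cB a Δx U₀ (fun c : PBond (F.P n) 0 =>
          (-Complex.I) • mlog (((V c : Matrix.specialUnitaryGroup (Fin 2) ℂ) : Matrix (Fin 2) (Fin 2) ℂ)
            * star ((descendTo F ℰp n K h U₀ c : Matrix.specialUnitaryGroup (Fin 2) ℂ) : Matrix (Fin 2) (Fin 2) ℂ)))))))))) = 0) :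
    (∀ (μ : Fin (F.P K).d) (x : Site (F.P K) 0),
        ‖covCodiffCurlT 1 (bgUnits F K U₀) ((fun b : PBond (F.P K) 0 => JetSup.equiv _ _ _ A₁ (bondEquiv F K b))
        + (fun b : PBond (F.P K) 0 => JetSup.equiv _ _ _ (H1f F n K h c₀ cB a Δx U₀ (fun c : PBond (F.P n) 0 =>
          (-Complex.I) • mlog (((V c : Matrix.specialUnitaryGroup (Fin 2) ℂ) : Matrix (Fin 2) (Fin 2) ℂ)
            * star ((descendTo F ℰp n K h U₀ c : Matrix.specialUnitaryGroup (Fin 2) ℂ) : Matrix (Fin 2) (Fin 2) ℂ)))) (bondEquiv F K b))) μ x‖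
          ≤ ((1 + 25 * C₄ * B₀ ^ 2) + cC * (1 + 25 * C₄ * B₀ ^ 2) + c137 * 2 + k139 * (10 * B₀) / 2 + 14 * (10 * B₀) + k349 * (10 * B₀) / 2 + 2 * (10 * B₀))
            * ((F.L : ℝ) ^ 3 * (3 * (F.L : ℝ)) * ε₁) * eta F n K ^ 2) ∧
      (∀ (ν : Fin (F.P K).d) (x : Site (F.P K) 0),
        ‖covLapFormT 1 (bgUnits F K U₀) ((fun b : PBond (F.P K) 0 => JetSup.equiv _ _ _ A₁ (bondEquiv F K b))
        + (fun b : PBond (F.P K) 0 => JetSup.equiv _ _ _ (H1f F n K h c₀ cB a Δx U₀ (fun c : PBond (F.P n) 0 =>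
          (-Complex.I) • mlog (((V c : Matrix.specialUnitaryGroup (Fin 2) ℂ) : Matrix (Fin 2) (Fin 2) ℂ)
            * star ((descendTo F ℰp n K h U₀ c : Matrix.specialUnitaryGroup (Fin 2) ℂ) : Matrix (Fin 2) (Fin 2) ℂ)))) (bondEquiv F K b))) ν x‖
          ≤ ((1 + 25 * C₄ * B₀ ^ 2) + cC * (1 + 25 * C₄ * B₀ ^ 2) + c137 * 2 + k139 * (10 * B₀) / 2 + 14 * (10 * B₀) + k349 * (10 * B₀) / 2 + 2 * (10 * B₀))
            * ((F.L : ℝ) ^ 3 * (3 * (F.L : ℝ)) * ε₁) * eta F n K ^ 2) := by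
  have hL : 0 < (F.L : ℝ) := Fact.out
  set ρ : ℝ := (F.L : ℝ) ^ 3 * (3 * (F.L : ℝ)) * ε₁ with hρdef
  have hρ : 0 < ρ := by positivity
  -- the datum `B̃` and (20): `‖B̃‖ < 2·3L·(L³ε₁) = 2ρ`
  set Bt : PBond (F.P n) 0 → Matrix (Fin 2) (Fin 2) ℂ := fun c : PBond (F.P n) 0 =>
    (-Complex.I) • mlog (((V c : Matrix.specialUnitaryGroup (Fin 2) ℂ) : Matrix (Fin 2) (Fin 2) ℂ)
      * star ((descendTo F ℰp n K h U₀ c : Matrix.specialUnitaryGroup (Fin 2) ℂ) : Matrix (Fin 2) (Fin 2) ℂ)) with hBtdef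
  have hBt : ‖Bt‖ < 2 * ((3 : ℝ) * F.L) * ((F.L : ℝ) ^ 3 * ε₁) := bound20_symLog_of_closeAvg F h hε₁ hwin V U₀ hclose
  have h2ρ : 2 * ((3 : ℝ) * F.L) * ((F.L : ℝ) ^ 3 * ε₁) = 2 * ρ := by rw [hρdef]; ring
  have hBt' : ‖Bt‖ ≤ 2 * ρ := by rw [← h2ρ]; exact hBt.le
  -- the letters of record, abbreviated
  set 𝒢 := frakGfR F n K h c₀ cB a Δx U₀ with h𝒢def
  set H₁ := H1f F n K h c₀ cB a Δx U₀ with hH₁def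
  -- (103)∕(117): `‖H₁B̃‖ ≤ B₀‖B̃‖ < 2B₀ρ`
  have h𝔄 : ‖H₁ Bt‖ < 2 * ((3 : ℝ) * F.L) * B₀ * (F.L : ℝ) ^ 3 * ε₁ := by
    calc ‖H₁ Bt‖ ≤ B₀ * ‖Bt‖ := norm_H₁ Bt
      _ < B₀ * (2 * ((3 : ℝ) * F.L) * ((F.L : ℝ) ^ 3 * ε₁)) := mul_lt_mul_of_pos_left hBt hB₀
      _ = 2 * ((3 : ℝ) * F.L) * B₀ * (F.L : ℝ) ^ 3 * ε₁ := by ring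
  have h𝔄' : ‖H₁ Bt‖ ≤ 2 * B₀ * ρ := by
    calc ‖H₁ Bt‖ ≤ B₀ * ‖Bt‖ := norm_H₁ Bt
      _ ≤ B₀ * (2 * ρ) := mul_le_mul_of_nonneg_left hBt' hB₀.le
      _ = 2 * B₀ * ρ := by ring
  -- Prop. 6 (116): the displayed solution IS the unique one, of size `< 3B₀ρ`
  obtain ⟨A, -, -, hAsize, huniq⟩ := prop6_bgOfCfg F K n U₀ (𝒢 := 𝒢) (W := W) norm_G quad hB₀ hC₄ (by positivity : (0 : ℝ) < (F.L : ℝ) ^ 3)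
    (by positivity : (0 : ℝ) < 3 * (F.L : ℝ)) hε₁ (le_refl _) h1 h2 h3 hreg (𝔄 := H₁ Bt) h𝔄
  have hA₁eq : A₁ = A := huniq A₁ hA₁ heq
  have hA₁size : ‖A₁‖ < 3 * B₀ * ρ := by
    rw [hA₁eq]; calc ‖A‖ < 3 * B₀ * (F.L : ℝ) ^ 3 * (3 * (F.L : ℝ)) * ε₁ := hAsize
      _ = 3 * B₀ * ρ := by rw [hρdef]; ring
  have hsum : ‖A₁ + H₁ Bt‖ ≤ 5 * B₀ * ρ := by
    calc ‖A₁ + H₁ Bt‖ ≤ ‖A₁‖ + ‖H₁ Bt‖ := norm_add_le _ _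
      _ ≤ 3 * B₀ * ρ + 2 * B₀ * ρ := add_le_add hA₁size.le h𝔄'
      _ = 5 * B₀ * ρ := by ring
  -- (97): `‖W(A₁ + H₁B̃)‖ ≤ C₄‖A₁ + H₁B̃‖² ≤ 25C₄B₀²ρ` (the argument is in the ball `a₃` by the windows `h1 h2`)
  have hball : ‖A₁ + H₁ Bt‖ < a₃ := by
    have : 5 * B₀ * ρ < a₃ := by rw [hρdef]; nlinarith [mul_pos hB₀ hρ]
    exact hsum.trans_lt this
  have hW : ‖W (A₁ + H₁ Bt)‖ ≤ 25 * C₄ * B₀ ^ 2 * ρ := by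
    calc ‖W (A₁ + H₁ Bt)‖ ≤ C₄ * ‖A₁ + H₁ Bt‖ ^ 2 := quad.quad _ hball
      _ ≤ C₄ * (5 * B₀ * ρ) ^ 2 := mul_le_mul_of_nonneg_left (pow_le_pow_left₀ (norm_nonneg _) hsum 2) hC₄.le
      _ = 25 * C₄ * B₀ ^ 2 * ρ * ρ := by ring
      _ ≤ 25 * C₄ * B₀ ^ 2 * ρ * 1 := mul_le_mul_of_nonneg_left hρ1 (by positivity)
      _ = 25 * C₄ * B₀ ^ 2 * ρ := by ring
  -- (28): `‖J‖ ≤ C₁B₃ε₁ = ρ`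
  have hJ : ‖Jcur (L := (F.L : ℝ)) (η := ((F.L : ℝ)⁻¹) ^ (K - n)) (lev₀ := fun _ : Bond 3 (periodsT3 F K) => K - n) (bgOfCfg F K U₀)‖ ≤ ρ :=
    norm_Jcur_le (L := (F.L : ℝ)) (η := ((F.L : ℝ)⁻¹) ^ (K - n)) (lev₀ := fun _ : Bond 3 (periodsT3 F K) => K - n) _ (isUnitaryBg_bgOfCfg F K U₀)
      (by positivity) (inU2cur_bgOfCfg_of_regPr (F := F) (K := K) n U₀ hreg)
  -- the `L²` reading of (111): `toL2 Yf = −𝔊(Ĵ + Ŵ) + H(toL2B B̃)`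
  set x : BondL2K ℂ 3 (periodsT3 F K) c₀ W₂ := (funEquiv frobEquiv (fun _ : Bond 3 (periodsT3 F K) => c₀)).symm
    (NegSup.equiv _ _ (Jcur (bgOfCfg F K U₀)) + NegSup.equiv _ _ (W (A₁ + H₁ Bt))) with hxdef
  set Yf : PBond (F.P K) 0 → Matrix (Fin 2) (Fin 2) ℂ := (fun b : PBond (F.P K) 0 => JetSup.equiv _ _ _ A₁ (bondEquiv F K b))
    + (fun b : PBond (F.P K) 0 => JetSup.equiv _ _ _ (H₁ Bt) (bondEquiv F K b)) with hYfdef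
  have hY : toL2 F K c₀ Yf = -(frakGT F n K h c₀ cB a Δx U₀ x) + HT F n K h c₀ cB a Δx U₀ (toL2B F n cB Bt) := by
    rw [hYfdef, Prop7Size19Orders01.iota_add F n K U₀ A₁ (H₁ Bt), hH₁def]
    exact toL2_iota_eq111 (Δx := Δx) U₀ A₁ _ _ Bt heq
  -- sizes: `nY := 5B₀ρ`, `sx := (1 + 25C₄B₀²)ρ`, `sb := 2ρ`
  have hYsup : ∀ bd, ‖Yf bd‖ ≤ 5 * B₀ * ρ := by
    intro bd
    rw [hYfdef, Pi.add_apply]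
    calc ‖JetSup.equiv _ _ _ A₁ (bondEquiv F K bd) + JetSup.equiv _ _ _ (H₁ Bt) (bondEquiv F K bd)‖
        ≤ ‖JetSup.equiv _ _ _ A₁ (bondEquiv F K bd)‖ + ‖JetSup.equiv _ _ _ (H₁ Bt) (bondEquiv F K bd)‖ := norm_add_le _ _
      _ ≤ ‖A₁‖ + ‖H₁ Bt‖ := add_le_add (norm_jetRead_apply_le A₁ bd) (norm_jetRead_apply_le (H₁ Bt) bd)
      _ ≤ 3 * B₀ * ρ + 2 * B₀ * ρ := add_le_add hA₁size.le h𝔄'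
      _ = 5 * B₀ * ρ := by ring
  have hnY : 5 * B₀ * ρ ≤ 10 * B₀ / 2 * ρ := by linarith
  have hx : ∀ bd, ‖(toL2 F K c₀).symm x bd‖ ≤ (1 + 25 * C₄ * B₀ ^ 2) * ρ := by
    intro bd
    rw [hxdef, toL2_symm_funEquiv_symm_apply, Pi.add_apply]
    calc ‖NegSup.equiv _ _ (Jcur (bgOfCfg F K U₀)) (bondEquiv F K bd) + NegSup.equiv _ _ (W (A₁ + H₁ Bt)) (bondEquiv F K bd)‖
        ≤ ‖NegSup.equiv _ _ (Jcur (bgOfCfg F K U₀)) (bondEquiv F K bd)‖ + ‖NegSup.equiv _ _ (W (A₁ + H₁ Bt)) (bondEquiv F K bd)‖ := norm_add_le _ _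
      _ ≤ ‖Jcur (L := (F.L : ℝ)) (η := ((F.L : ℝ)⁻¹) ^ (K - n)) (lev₀ := fun _ : Bond 3 (periodsT3 F K) => K - n) (bgOfCfg F K U₀)‖ + ‖W (A₁ + H₁ Bt)‖ :=
          add_le_add (norm_negSup_equiv_apply_le _ _) (norm_negSup_equiv_apply_le _ _)
      _ ≤ ρ + 25 * C₄ * B₀ ^ 2 * ρ := add_le_add hJ hW
      _ = (1 + 25 * C₄ * B₀ ^ 2) * ρ := by ring
  have hb : ∀ c : PBond (F.P n) 0, ‖(toL2B F n cB).symm (toL2B F n cB Bt) c‖ ≤ 2 * ρ := fun c => by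
    rw [LinearEquiv.symm_apply_apply]; exact (norm_le_pi_norm Bt c).trans hBt'
  -- ONE call to ★px5's junction with the four operator rows
  have hmain := secondOrder_of_eq111_opRows127_rho (cx := 1 + 25 * C₄ * B₀ ^ 2) (cb := 2) (B₁ := 10 * B₀) hρ.le hρ1 hreg hp hkill horth x (toL2B F n cB Bt) Yf hY
    hYsup hnY hx le_rfl hb le_rfl hOpC hmult h137 hOp139 hOp349
  simpa only [hYfdef, hH₁def, hBtdef] using hmain

end Summit.QuantumFields.YangMills.Theorems.Prop7HDsolAtRecordOfRows127

end
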